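/-
Copyright (c) 2026 the pub-hodgecm-mathlib formalisation cell (harness21).  Prover seat hodgecm-mathlib-K2E1-p09 (g6), Track B ∕ K2-LIT, h413 =
`stmt-HodgeConjecture-24833`, ENGINE E1, campaign «EIS-R7-BL-SPH-2» (Bernstein–Lapid soft continuation of the spherical Borel Eisenstein series of `U(1,1)`), deal «BL-P3» of the
dealer K2E1-plan (g5) (2026-09-04T08:34:39Z (3) ∕ 08:41:11Z; (ζ′) WIRING `K2/K2E1b-plan/g6/WIRING-EIS-R7-BL-SPH-2.K2E1b-plan-g6.md` 7d1cceb628a30de8 §3 P3), FILE A (function level).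
-/
import Literature.NumberTheory.Automorphic.AdelicHeightZetaUniform                -- ★ `exists_matHeightBound_le_of_isCompact`
import Literature.NumberTheory.Automorphic.UnitaryGroupTruncationFiniteSum        -- ★ `borelHeight_rational_mul_le` (rank `N`)
import Literature.NumberTheory.Automorphic.UnitaryGroupBorelHeightContinuous      -- ★ `continuous_borelHeight`, `vecHeight_lastRow_pos`
import Literature.NumberTheory.Automorphic.UnitaryGroupTorusSiegelIntegral         -- ★ `borelHeight_pos`
import HarnessLib

/-!
# K2·E1 — `K2E1BLHeckeOperatorWeightedU2` («EIS-R7-BL-SPH-2», P3, FILE A — FUNCTION LEVEL): HEIGHTS MOVE BOUNDEDLY UNDER A COMPACT SET, `w₁(x·y) ≍ w₁(x)`, AND THE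
# POINTWISE WEIGHTED CAUCHY–SCHWARZ ESTIMATE FOR BERNSTEIN–LAPID'S `δ(h) = R(h)` (LEAF-INDEPENDENT, ON `G(𝔸)`)

Track B ∕ K2-LIT, crux h413 = `stmt-HodgeConjecture-24833`, route of record `HCCMUnconditional`; cell `hodgecm-mathlib`, squad K2, ENGINE E1 (campaign «EIS-R7-BL», (ζ′) WIRING §3 P3:
«`δ(h) := R(h)` is bounded on `𝓗_k(𝔛)` and on `𝓗_k(Z_c)` (`H(xy) ≍ H(x)`, `w₁(xy) ≍ w₁(x)` for `y ∈ supp h` compact), `deltaShift` well-defined (D7)»).  Dealer K2E1-plan (g5):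
«type the FUNCTION-LEVEL inequalities first (no `Lp` needed), wrap in `Lp` after the Defs leaf is 📤».  Prover seat `hodgecm-mathlib-K2E1-p09` (g6).  THEOREMS ONLY (no `def`, no
`instance`, no notation, no named-fact hypothesis, no `sorry`; default heartbeats); lane `--supports stmt-HodgeConjecture-24833 --as helper` (count-neutral).  Closes no socket.
RANK-GENERIC (`quasiSplit F E c N`, any `N`): the BL-SPH-3 clone reuses this file verbatim ((ζ′) §4 clone discipline).

THE MATHEMATICS [BernsteinLapid2019, §4 p. 10; MoeglinWaldspurger1995, I.2.2, I.2.13; Garrett2018, Thm. 2.2.2].  Bernstein–Lapid's operator `δ(h) = R(h)`,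
`(R(h)φ)(z) = ∫_{G(𝔸)} h(y) φ(z·y) dν_G(y)` for `h` of compact support `Ω`, is bounded on the weighted spaces `𝓗_k(Z_c) = L²({H > c}; H^{−2k}dz)` because the Borel height moves
boundedly under `Ω`: from `lastRow(x·y) = lastRow(x)·y` and Godement's `h(v·M) ≤ H_mat(M)·h(v)` (★ `vecHeight_vecMul_le`),
  **`H(x·y) ≤ H_mat(y⁻¹)·H(x)`** for all `x, y ∈ G(𝔸)` (§1; the rank-`N` twin of ★ BL-R1 `K2E1BLHeightCosetsU2.borelHeight_mul_le_matHeightBound_mul`),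
and `H_mat` is bounded on compact sets of adelic matrices (★ `exists_matHeightBound_le_of_isCompact`), so **`κ_Ω⁻¹·H(x) ≤ H(x·y) ≤ κ_Ω·H(x)` for `y ∈ Ω`** (§1), hence the support clause `H(x) > κ_Ω c ⟹ H(x·y) > c` (§2)
and the same comparison for the weight **`w₁(x) = sup_{γ ∈ G(F)} H(γ·x)`** (§3: `w₁(x·y) ≤ κ_Ω·w₁(x) ≤ κ_Ω²·w₁(x·y)`; the family `γ ↦ H(γ x)` is bounded by ★
`borelHeight_rational_mul_le`).  The POINTWISE estimate behind every `L²` bound (§4–§5): the weighted Cauchy–Schwarz inequality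
  **`‖∫ h·u dν‖² ≤ (∫ ‖h‖ dν) · ∫ ‖h‖·‖u‖² dν`** (discriminant of `λ ↦ ∫ ‖h‖(λ − ‖u‖)² ≥ 0`; generic measure space), applied to `u(y) = φ(z·y)`, and for `supp h ⊆ Ω`,
`x ∈ G(𝔸)` and `k ∈ ℕ`:  **`H(x)^{−2k}·‖(R(h)φ)(x)‖² ≤ κ_Ω^{2k}·‖h‖₁·∫ ‖h(y)‖·H(x·y)^{−2k}·‖φ(x·y)‖² dν(y)`** (since `H(x·y) ≤ κ_Ω H(x)` on `supp h`) — stated for functions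
on `G(𝔸)` (it descends verbatim to `Z = B(F)∖G(𝔸)` of the leaf of record `K2E1BLBorelSpacesU2Defs`, RULING «Z := B(F)∖G(𝔸)» 08:57:54Z, or to any left quotient by a subgroup of
`G(F)`): this is the letter `ShiftBound` of the operator leaf (D7 `deltaShift`) MINUS Fubini on `G(𝔸) × Z_{c₀}` and the right-invariance of `μZ`, which are FILE B (`shiftBound_of_…`,
after that leaf lands).

* §1 **`borelHeight_mul_le_matHeightBound_inv_mul`** (rank `N`), **`exists_borelHeight_mul_le_of_isCompact`** (`κ_Ω ≥ 1`, two-sided).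
* §2 `lt_borelHeight_mul_of_lt` (support clause).
* §3 `bddAbove_range_borelHeight_arith_mul`, **`exists_ciSup_borelHeight_mul_le_of_isCompact`** (`w₁(x·y) ≤ κ·w₁(x)` and `w₁(x) ≤ κ·w₁(x·y)`).
* §4 **`sq_integral_norm_mul_le`**, **`norm_sq_integral_mul_le`** (weighted Cauchy–Schwarz, generic).
* §5 **`inv_pow_mul_norm_sq_rightConv_le`** — the pointwise weighted estimate for `R(h)` (on `G(𝔸)`; leaf-independent).
HONEST LABEL: HC_CM is proved only modulo the 7 printed citations (2 remaining named inputs: hLiu418 = `stmt-HodgeConjecture-24832`, h413 = `stmt-HodgeConjecture-24833`) until rung 0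
closes; this file asserts no named fact and closes no socket; count-neutral.  NOT HERE (FILE B): the discharge of `ShiftBound` (Fubini + right-invariance of `μZ`), the `𝓗_k(𝔛)` bound
and the pointwise-evaluation bridge `𝓗_k(𝔛) → w₁^{−k′}L^∞` (needs the covering multiplicity ★ BL-R1 `K2E1BLReductionCoveringU2`).

## References
* [BernsteinLapid2019] J. Bernstein, E. Lapid, *On the meromorphic continuation of Eisenstein series*, J. Amer. Math. Soc. 37 (2024) (arXiv:1911.02342): §4 p. 10 (`δ(h)`, Claim 4).
* [MoeglinWaldspurger1995] C. Mœglin, J.-L. Waldspurger, *Spectral Decomposition and Eisenstein Series* (1995): I.2.2 (heights under compact sets), I.2.13 (weighted `L²`).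
* [Garrett2018] P. Garrett, *Modern Analysis of Automorphic Forms by Example* (2018): Thm. 2.2.2 (`h(xg) ≪_g h(x)`), Cor. 3.3.3.
-/

set_option autoImplicit false
set_option linter.dupNamespace false  -- the mandated namespace repeats the summit's segment (`HodgeConjecture.HodgeConjecture`)

noncomputable section

open MeasureTheory NumberField IsDedekindDomain Filter Topology Set Matrix
open scoped NNReal ENNReal MatrixGroups
open Literature.NumberTheory.Automorphic Literature.NumberTheory.Automorphic.UnitaryGroup AdelicGroupData

namespace Summit.HodgeConjecture.HodgeConjecture.Cruxes.H413.K2E1BLHeckeOperatorWeightedU2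

section Heights

variable {F E : Type} [Field F] [NumberField F] [Field E] [NumberField E] [Algebra F E] {c : E ≃ₐ[F] E} {N : ℕ} [NeZero N]

/-! ## §1 Heights move boundedly under right multiplication by a compact set -/

/-- **`H(x·y) ≤ H_mat(y⁻¹)·H(x)`** for all `x, y ∈ G(𝔸)` (rank `N`): `lastRow(x) = lastRow(x·y)·y⁻¹`, so `h(lastRow x) ≤ H_mat(y⁻¹)·h(lastRow(x·y))` (★ `vecHeight_vecMul_le`), and
`H = h(lastRow)⁻¹`.  The rank-`N` twin of ★ BL-R1 `K2E1BLHeightCosetsU2.borelHeight_mul_le_matHeightBound_mul`. [cite: Garrett2018, Thm. 2.2.2 (PDF p. 82)] [cite: MoeglinWaldspurger1995, I.2.2] -/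
theorem borelHeight_mul_le_matHeightBound_inv_mul (x y : (quasiSplit F E c N).Adelic) :
    borelHeight (x * y) ≤ matHeightBound E (((adelicVal F E c N _ y)⁻¹ : GL (Fin N) (AdeleRing (𝓞 E) E)) : Matrix (Fin N) (Fin N) (AdeleRing (𝓞 E) E)) * borelHeight x := by
  set M := matHeightBound E (((adelicVal F E c N _ y)⁻¹ : GL (Fin N) (AdeleRing (𝓞 E) E)) : Matrix (Fin N) (Fin N) (AdeleRing (𝓞 E) E)) with hM
  have hback : lastRow (x * y) ᵥ* (((adelicVal F E c N _ y)⁻¹ : GL (Fin N) (AdeleRing (𝓞 E) E)) : Matrix (Fin N) (Fin N) (AdeleRing (𝓞 E) E)) = lastRow x := by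
    rw [lastRow_mul, Matrix.vecMul_vecMul, ← Units.val_mul, mul_inv_cancel, Units.val_one, Matrix.vecMul_one]
  have hle : vecHeight E (lastRow x) ≤ M * vecHeight E (lastRow (x * y)) := by
    have h := vecHeight_vecMul_le (K := E) (isHeightFinite_lastRow (x * y))
      (M := (((adelicVal F E c N _ y)⁻¹ : GL (Fin N) (AdeleRing (𝓞 E) E)) : Matrix (Fin N) (Fin N) (AdeleRing (𝓞 E) E))) (by rw [hback]; exact isHeightFinite_lastRow x)
    rwa [hback] at h
  have hx0 : 0 < vecHeight E (lastRow x) := vecHeight_lastRow_pos x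
  have hxy0 : 0 < vecHeight E (lastRow (x * y)) := vecHeight_lastRow_pos (x * y)
  rw [borelHeight_def, borelHeight_def]
  calc (vecHeight E (lastRow (x * y)))⁻¹
      = vecHeight E (lastRow x) * (vecHeight E (lastRow x))⁻¹ * (vecHeight E (lastRow (x * y)))⁻¹ := by rw [mul_inv_cancel₀ hx0.ne', one_mul]
    _ ≤ (M * vecHeight E (lastRow (x * y))) * (vecHeight E (lastRow x))⁻¹ * (vecHeight E (lastRow (x * y)))⁻¹ := by gcongr
    _ = M * (vecHeight E (lastRow x))⁻¹ * (vecHeight E (lastRow (x * y)) * (vecHeight E (lastRow (x * y)))⁻¹) := by ring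
    _ = M * (vecHeight E (lastRow x))⁻¹ := by rw [mul_inv_cancel₀ hxy0.ne', mul_one]

/-- **HEIGHTS MOVE BOUNDEDLY UNDER A COMPACT SET**: for `Ω ⊆ G(𝔸)` compact there is `κ ≥ 1` with `H(x·y) ≤ κ·H(x)` and `H(x) ≤ κ·H(x·y)` for all `x ∈ G(𝔸)`, `y ∈ Ω`
(§1 applied to `(x, y)` and to `(x·y, y⁻¹)`; `H_mat` is bounded on the compact sets `{y⁻¹ : y ∈ Ω}`, `{y : y ∈ Ω}` of adelic matrices, ★ `exists_matHeightBound_le_of_isCompact`).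
[cite: MoeglinWaldspurger1995, I.2.2] [cite: BernsteinLapid2019, §4 p. 10] -/
theorem exists_borelHeight_mul_le_of_isCompact {Ω : Set (quasiSplit F E c N).Adelic} (hΩ : IsCompact Ω) :
    ∃ κ : ℝ≥0, 1 ≤ κ ∧ ∀ x : (quasiSplit F E c N).Adelic, ∀ y ∈ Ω, borelHeight (x * y) ≤ κ * borelHeight x ∧ borelHeight x ≤ κ * borelHeight (x * y) := by
  have hinv : Continuous fun y : (quasiSplit F E c N).Adelic =>
      (((adelicVal F E c N _ y)⁻¹ : GL (Fin N) (AdeleRing (𝓞 E) E)) : Matrix (Fin N) (Fin N) (AdeleRing (𝓞 E) E)) :=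
    Units.continuous_coe_inv.comp continuous_subtype_val
  have hval : Continuous fun y : (quasiSplit F E c N).Adelic =>
      ((adelicVal F E c N _ y : GL (Fin N) (AdeleRing (𝓞 E) E)) : Matrix (Fin N) (Fin N) (AdeleRing (𝓞 E) E)) :=
    Units.continuous_val.comp continuous_subtype_val
  obtain ⟨M₁, hM₁⟩ := exists_matHeightBound_le_of_isCompact (K := E) (hΩ.image hinv)
  obtain ⟨M₂, hM₂⟩ := exists_matHeightBound_le_of_isCompact (K := E) (hΩ.image hval)
  refine ⟨max 1 (max M₁ M₂), le_max_left _ _, fun x y hy => ⟨?_, ?_⟩⟩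
  · calc borelHeight (x * y) ≤ matHeightBound E (((adelicVal F E c N _ y)⁻¹ : GL (Fin N) (AdeleRing (𝓞 E) E)) : Matrix (Fin N) (Fin N) (AdeleRing (𝓞 E) E)) * borelHeight x :=
          borelHeight_mul_le_matHeightBound_inv_mul x y
      _ ≤ max 1 (max M₁ M₂) * borelHeight x :=
          mul_le_mul_of_nonneg_right ((hM₁ _ ⟨y, hy, rfl⟩).trans ((le_max_left _ _).trans (le_max_right _ _))) zero_le
  · have h := borelHeight_mul_le_matHeightBound_inv_mul (x * y) y⁻¹
    rw [mul_inv_cancel_right, map_inv, inv_inv] at h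
    calc borelHeight x ≤ matHeightBound E ((adelicVal F E c N _ y : GL (Fin N) (AdeleRing (𝓞 E) E)) : Matrix (Fin N) (Fin N) (AdeleRing (𝓞 E) E)) * borelHeight (x * y) := h
      _ ≤ max 1 (max M₁ M₂) * borelHeight (x * y) :=
          mul_le_mul_of_nonneg_right ((hM₂ _ ⟨y, hy, rfl⟩).trans ((le_max_right _ _).trans (le_max_right _ _))) zero_le

/-! ## §2 The support clause -/

/-- **THE SUPPORT CLAUSE**: if `H(x) ≤ κ·H(x·y)` (`κ > 0`) and `κ·c < H(x)`, then `c < H(x·y)` — right translation by `y ∈ Ω` maps `{H > κ_Ω·c}` into `{H > c}`, so `R(h)` of a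
function vanishing on `{H > c}` vanishes on `{H > κ_Ω c}` (B–L: «`δ(h)` maps functions supported in `Z_c^-` to functions supported in `Z_{c₀}^-`»). [cite: BernsteinLapid2019, §4 p. 10] -/
theorem lt_borelHeight_mul_of_lt {κ c₁ : ℝ≥0} (hκ : 0 < κ) {x y : (quasiSplit F E c N).Adelic} (hxy : borelHeight x ≤ κ * borelHeight (x * y))
    (hx : κ * c₁ < borelHeight x) : c₁ < borelHeight (x * y) :=
  lt_of_mul_lt_mul_left (hx.trans_le hxy) hκ.le

/-! ## §3 The weight `w₁(x) = sup_{γ ∈ G(F)} H(γ·x)` under a compact set -/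

/-- The family `γ ↦ H(γ·x)`, `γ ∈ G(F)`, is bounded above (by `H_mat(x⁻¹)`, ★ `borelHeight_rational_mul_le`; rank `N`). [cite: Garrett2018, Cor. 3.3.3 (PDF p. 163)] -/
theorem bddAbove_range_borelHeight_arith_mul (x : (quasiSplit F E c N).Adelic) :
    BddAbove (Set.range fun γ : (quasiSplit F E c N).arithmeticSubgroup => borelHeight ((γ : (quasiSplit F E c N).Adelic) * x)) := by
  refine ⟨matHeightBound E (((adelicVal F E c N _ x)⁻¹ : GL (Fin N) (AdeleRing (𝓞 E) E)) : Matrix (Fin N) (Fin N) (AdeleRing (𝓞 E) E)), ?_⟩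
  rintro _ ⟨γ, rfl⟩
  exact borelHeight_rational_mul_le γ x

/-- **`w₁(x·y) ≤ κ·w₁(x)` AND `w₁(x) ≤ κ·w₁(x·y)`** for `y` in a compact `Ω`, `w₁(x) = ⨆_{γ ∈ G(F)} H(γ·x)` (termwise §1 with `γ·x` in place of `x`, then `ciSup_le` ∕ `le_ciSup`).
[cite: BernsteinLapid2019, §4 p. 10] [cite: MoeglinWaldspurger1995, I.2.2] -/
theorem exists_ciSup_borelHeight_mul_le_of_isCompact {Ω : Set (quasiSplit F E c N).Adelic} (hΩ : IsCompact Ω) :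
    ∃ κ : ℝ≥0, 1 ≤ κ ∧ ∀ x : (quasiSplit F E c N).Adelic, ∀ y ∈ Ω,
      (⨆ γ : (quasiSplit F E c N).arithmeticSubgroup, borelHeight ((γ : (quasiSplit F E c N).Adelic) * (x * y))) ≤
          κ * ⨆ γ : (quasiSplit F E c N).arithmeticSubgroup, borelHeight ((γ : (quasiSplit F E c N).Adelic) * x) ∧
        (⨆ γ : (quasiSplit F E c N).arithmeticSubgroup, borelHeight ((γ : (quasiSplit F E c N).Adelic) * x)) ≤
          κ * ⨆ γ : (quasiSplit F E c N).arithmeticSubgroup, borelHeight ((γ : (quasiSplit F E c N).Adelic) * (x * y)) := by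
  obtain ⟨κ, hκ1, hκ⟩ := exists_borelHeight_mul_le_of_isCompact hΩ
  refine ⟨κ, hκ1, fun x y hy => ⟨ciSup_le fun γ => ?_, ciSup_le fun γ => ?_⟩⟩
  · calc borelHeight ((γ : (quasiSplit F E c N).Adelic) * (x * y)) = borelHeight ((γ : (quasiSplit F E c N).Adelic) * x * y) := by rw [mul_assoc]
      _ ≤ κ * borelHeight ((γ : (quasiSplit F E c N).Adelic) * x) := (hκ _ y hy).1
      _ ≤ κ * ⨆ γ' : (quasiSplit F E c N).arithmeticSubgroup, borelHeight ((γ' : (quasiSplit F E c N).Adelic) * x) :=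
          mul_le_mul_of_nonneg_left (le_ciSup (bddAbove_range_borelHeight_arith_mul x) γ) zero_le
  · calc borelHeight ((γ : (quasiSplit F E c N).Adelic) * x) ≤ κ * borelHeight ((γ : (quasiSplit F E c N).Adelic) * x * y) := (hκ _ y hy).2
      _ = κ * borelHeight ((γ : (quasiSplit F E c N).Adelic) * (x * y)) := by rw [mul_assoc]
      _ ≤ κ * ⨆ γ' : (quasiSplit F E c N).arithmeticSubgroup, borelHeight ((γ' : (quasiSplit F E c N).Adelic) * (x * y)) :=
          mul_le_mul_of_nonneg_left (le_ciSup (bddAbove_range_borelHeight_arith_mul (x * y)) γ) zero_le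

end Heights

/-! ## §4 The weighted Cauchy–Schwarz inequality `‖∫ h·u‖² ≤ ‖h‖₁ · ∫ ‖h‖·‖u‖²` (generic measure space) -/

section CauchySchwarz

variable {α : Type*} [MeasurableSpace α] (ν : Measure α)

/-- **`(∫ ‖h‖·‖u‖)² ≤ (∫ ‖h‖)·(∫ ‖h‖·‖u‖²)`** (the discriminant of `λ ↦ ∫ ‖h‖·(λ − ‖u‖)² ≥ 0`), for `h` integrable and `‖h‖·‖u‖²` integrable (then `‖h‖·‖u‖` is integrable too:
`2ab ≤ a + ab²`). [folklore] -/
theorem sq_integral_norm_mul_le {h u : α → ℂ} (hh : Integrable h ν) (hu : AEStronglyMeasurable u ν) (h2 : Integrable (fun y => ‖h y‖ * ‖u y‖ ^ 2) ν) :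
    (∫ y, ‖h y‖ * ‖u y‖ ∂ν) ^ 2 ≤ (∫ y, ‖h y‖ ∂ν) * ∫ y, ‖h y‖ * ‖u y‖ ^ 2 ∂ν := by
  set A := ∫ y, ‖h y‖ ∂ν with hA
  set B := ∫ y, ‖h y‖ * ‖u y‖ ∂ν with hB
  set C := ∫ y, ‖h y‖ * ‖u y‖ ^ 2 ∂ν with hC
  have hA0 : 0 ≤ A := integral_nonneg fun y => norm_nonneg _
  have hC0 : 0 ≤ C := integral_nonneg fun y => mul_nonneg (norm_nonneg _) (sq_nonneg _)
  -- `‖h‖·‖u‖` is integrable: `‖h‖‖u‖ ≤ ‖h‖ + ‖h‖‖u‖²` (`t ≤ 1 + t²`)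
  have h1 : Integrable (fun y => ‖h y‖ * ‖u y‖) ν := by
    refine Integrable.mono' (hh.norm.add h2) (hh.norm.aestronglyMeasurable.mul hu.norm) (Eventually.of_forall fun y => ?_)
    rw [Real.norm_of_nonneg (mul_nonneg (norm_nonneg _) (norm_nonneg _)), Pi.add_apply, ← mul_one_add (‖h y‖)]
    refine mul_le_mul_of_nonneg_left ?_ (norm_nonneg _)
    nlinarith [sq_nonneg (‖u y‖ - 1), norm_nonneg (u y)]
  -- the quadratic `q(λ) = ∫ ‖h‖(λ − ‖u‖)² = A λ² − 2 B λ + C ≥ 0`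
  have hq : ∀ t : ℝ, 0 ≤ A * t ^ 2 - 2 * B * t + C := by
    intro t
    have hint : ∫ y, ‖h y‖ * (t - ‖u y‖) ^ 2 ∂ν = A * t ^ 2 - 2 * B * t + C := by
      have hexp : (fun y => ‖h y‖ * (t - ‖u y‖) ^ 2) = fun y => (t ^ 2 * ‖h y‖ - 2 * t * (‖h y‖ * ‖u y‖)) + ‖h y‖ * ‖u y‖ ^ 2 := by
        funext y; ring
      have hadd : ∫ y, (t ^ 2 * ‖h y‖ - 2 * t * (‖h y‖ * ‖u y‖)) + ‖h y‖ * ‖u y‖ ^ 2 ∂ν =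
          (∫ y, t ^ 2 * ‖h y‖ - 2 * t * (‖h y‖ * ‖u y‖) ∂ν) + ∫ y, ‖h y‖ * ‖u y‖ ^ 2 ∂ν :=
        integral_add (f := fun y => t ^ 2 * ‖h y‖ - 2 * t * (‖h y‖ * ‖u y‖)) ((hh.norm.const_mul (t ^ 2)).sub (h1.const_mul (2 * t))) h2
      have hsub : ∫ y, t ^ 2 * ‖h y‖ - 2 * t * (‖h y‖ * ‖u y‖) ∂ν = (∫ y, t ^ 2 * ‖h y‖ ∂ν) - ∫ y, 2 * t * (‖h y‖ * ‖u y‖) ∂ν :=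
        integral_sub (f := fun y => t ^ 2 * ‖h y‖) (g := fun y => 2 * t * (‖h y‖ * ‖u y‖)) (hh.norm.const_mul (t ^ 2)) (h1.const_mul (2 * t))
      rw [hexp, hadd, hsub, integral_const_mul, integral_const_mul]
      ring
    rw [← hint]
    exact integral_nonneg fun y => mul_nonneg (norm_nonneg _) (sq_nonneg _)
  rcases hA0.eq_or_lt with hA00 | hApos
  · -- `A = 0`: then `‖h‖ = 0` a.e., so `B = 0`
    have hB0 : B = 0 := by
      have hae : (fun y => ‖h y‖) =ᵐ[ν] 0 := (integral_eq_zero_iff_of_nonneg (fun y => norm_nonneg _) hh.norm).1 hA00.symm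
      rw [hB]
      refine integral_eq_zero_of_ae ?_
      filter_upwards [hae] with y hy
      rw [Pi.zero_apply] at hy
      rw [hy, zero_mul, Pi.zero_apply]
    rw [hB0, ← hA00]
    simp
  · -- `A > 0`: evaluate at `t = B / A`
    have h := hq (B / A)
    have hcalc : A * (B / A) ^ 2 - 2 * B * (B / A) + C = C - B ^ 2 / A := by field_simp; ring
    rw [hcalc, sub_nonneg, div_le_iff₀ hApos] at h
    linarith [h, mul_comm A C]

/-- **WEIGHTED CAUCHY–SCHWARZ**: `‖∫ h·u dν‖² ≤ (∫ ‖h‖ dν) · ∫ ‖h‖·‖u‖² dν` (`h` integrable, `u` a.e.-strongly measurable, `‖h‖·‖u‖²` integrable). [folklore] -/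
theorem norm_sq_integral_mul_le {h u : α → ℂ} (hh : Integrable h ν) (hu : AEStronglyMeasurable u ν) (h2 : Integrable (fun y => ‖h y‖ * ‖u y‖ ^ 2) ν) :
    ‖∫ y, h y * u y ∂ν‖ ^ 2 ≤ (∫ y, ‖h y‖ ∂ν) * ∫ y, ‖h y‖ * ‖u y‖ ^ 2 ∂ν := by
  have h1 : ‖∫ y, h y * u y ∂ν‖ ≤ ∫ y, ‖h y‖ * ‖u y‖ ∂ν := by
    refine (norm_integral_le_integral_norm _).trans (le_of_eq (integral_congr_ae (Eventually.of_forall fun y => ?_)))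
    simp only [norm_mul]
  calc ‖∫ y, h y * u y ∂ν‖ ^ 2 ≤ (∫ y, ‖h y‖ * ‖u y‖ ∂ν) ^ 2 := pow_le_pow_left₀ (norm_nonneg _) h1 2
    _ ≤ (∫ y, ‖h y‖ ∂ν) * ∫ y, ‖h y‖ * ‖u y‖ ^ 2 ∂ν := sq_integral_norm_mul_le ν hh hu h2

end CauchySchwarz

/-! ## §5 The pointwise weighted estimate for `R(h)` (functions on `G(𝔸)`; it descends verbatim to any quotient `Γ'∖G(𝔸)` by a subgroup `Γ' ≤ G(F)` acting on the left) -/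

section RightConv

variable {F E : Type} [Field F] [NumberField F] [Field E] [NumberField E] [Algebra F E] {c : E ≃ₐ[F] E} {N : ℕ} [NeZero N]
variable [MeasurableSpace (quasiSplit F E c N).Adelic] [BorelSpace (quasiSplit F E c N).Adelic] (νG : Measure (quasiSplit F E c N).Adelic)

/-- **THE POINTWISE WEIGHTED ESTIMATE FOR BERNSTEIN–LAPID'S `δ(h) = R(h)`.**  Let `κ` satisfy `H(x·y) ≤ κ·H(x)` and `H(x) ≤ κ·H(x·y)` for `y ∈ Ω` (§1), `h` integrable with `h = 0` off
`Ω`, `φ : G(𝔸) → ℂ` with `y ↦ φ(x·y)` a.e.-strongly measurable and `‖h‖·‖φ(x·)‖²` integrable.  Then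
`H(x)^{−2k}·‖∫ h(y) φ(x·y) dν(y)‖² ≤ κ^{2k}·(∫‖h‖)·∫ ‖h(y)‖·(H(x·y)^{−2k}·‖φ(x·y)‖²) dν(y)` — the integrand of the `𝓗_k(Z_{c₀})`-norm of `R(h)φ` is dominated, point by point, by
`κ^{2k}‖h‖₁` times an `|h|`-average over `Ω` of the integrand of the `𝓗_k(Z_c)`-norm of `φ` at the translates; for left-`B(F)`-invariant `φ` both sides are functions on `Z = B(F)∖G(𝔸)`
(FILE B integrates this over `Z_{c₀}` by Fubini and the right-invariance of `μZ`).  [cite: BernsteinLapid2019, §4 p. 10] [cite: MoeglinWaldspurger1995, I.2.13] -/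
theorem inv_pow_mul_norm_sq_rightConv_le {Ω : Set (quasiSplit F E c N).Adelic} {κ : ℝ≥0}
    (hΩ : ∀ x : (quasiSplit F E c N).Adelic, ∀ y ∈ Ω, borelHeight (x * y) ≤ κ * borelHeight x ∧ borelHeight x ≤ κ * borelHeight (x * y))
    {h : (quasiSplit F E c N).Adelic → ℂ} (hh : Integrable h νG) (hsupp : ∀ y, y ∉ Ω → h y = 0) (k : ℕ) (x : (quasiSplit F E c N).Adelic) {φ : (quasiSplit F E c N).Adelic → ℂ}
    (hφm : AEStronglyMeasurable (fun y => φ (x * y)) νG) (hφ2 : Integrable (fun y => ‖h y‖ * ‖φ (x * y)‖ ^ 2) νG) :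
    (((borelHeight x)⁻¹ ^ (2 * k) : ℝ≥0) : ℝ) * ‖∫ y, h y * φ (x * y) ∂νG‖ ^ 2 ≤
      ((κ ^ (2 * k) : ℝ≥0) : ℝ) * (∫ y, ‖h y‖ ∂νG) * ∫ y, ‖h y‖ * ((((borelHeight (x * y))⁻¹ ^ (2 * k) : ℝ≥0) : ℝ) * ‖φ (x * y)‖ ^ 2) ∂νG := by
  have hx0 : 0 < borelHeight x := borelHeight_pos x
  -- `a ≤ κ b` (both positive) gives `b⁻¹ ≤ κ a⁻¹`, then powers
  have hinv : ∀ {a b : ℝ≥0}, 0 < a → 0 < b → a ≤ κ * b → (b⁻¹) ^ (2 * k) ≤ κ ^ (2 * k) * (a⁻¹) ^ (2 * k) := by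
    intro a b ha hb hab
    have h1 : b⁻¹ ≤ κ * a⁻¹ := by
      rw [← div_eq_mul_inv, le_div_iff₀ ha, inv_mul_le_iff₀ hb, mul_comm]
      exact hab
    rw [← mul_pow]; exact pow_le_pow_left₀ zero_le h1 _
  -- (1) the weight comparison on `Ω` in both directions
  have hw : ∀ y ∈ Ω, (((borelHeight x)⁻¹ ^ (2 * k) : ℝ≥0) : ℝ) ≤ ((κ ^ (2 * k) : ℝ≥0) : ℝ) * (((borelHeight (x * y))⁻¹ ^ (2 * k) : ℝ≥0) : ℝ) := fun y hy => by
    exact_mod_cast hinv (borelHeight_pos (x * y)) hx0 (hΩ x y hy).1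
  have hw' : ∀ y ∈ Ω, (((borelHeight (x * y))⁻¹ ^ (2 * k) : ℝ≥0) : ℝ) ≤ ((κ ^ (2 * k) : ℝ≥0) : ℝ) * (((borelHeight x)⁻¹ ^ (2 * k) : ℝ≥0) : ℝ) := fun y hy => by
    exact_mod_cast hinv hx0 (borelHeight_pos (x * y)) (hΩ x y hy).2
  -- (2) integrability of the weighted integrand (dominated by a constant multiple of `‖h‖‖φ(x·)‖²`; the weight is continuous in `y`, ★ `continuous_borelHeight`)
  have hc1 : Continuous fun y : (quasiSplit F E c N).Adelic => borelHeight (x * y) := continuous_borelHeight.comp (continuous_const_mul x)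
  have hc2 : Continuous fun y : (quasiSplit F E c N).Adelic => (borelHeight (x * y))⁻¹ ^ (2 * k) := (hc1.inv₀ fun y => (borelHeight_pos (x * y)).ne').pow (2 * k)
  have hwc : Continuous fun y : (quasiSplit F E c N).Adelic => (((borelHeight (x * y))⁻¹ ^ (2 * k) : ℝ≥0) : ℝ) := NNReal.continuous_coe.comp hc2
  have hint2 : Integrable (fun y => ‖h y‖ * ((((borelHeight (x * y))⁻¹ ^ (2 * k) : ℝ≥0) : ℝ) * ‖φ (x * y)‖ ^ 2)) νG := by
    refine Integrable.mono' (hφ2.const_mul (((κ ^ (2 * k) : ℝ≥0) : ℝ) * (((borelHeight x)⁻¹ ^ (2 * k) : ℝ≥0) : ℝ)))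
      (hh.norm.aestronglyMeasurable.mul (hwc.aestronglyMeasurable.mul (hφm.norm.pow 2))) (Eventually.of_forall fun y => ?_)
    rw [Real.norm_of_nonneg (mul_nonneg (norm_nonneg _) (mul_nonneg (NNReal.coe_nonneg _) (sq_nonneg _)))]
    by_cases hy : y ∈ Ω
    · calc ‖h y‖ * ((((borelHeight (x * y))⁻¹ ^ (2 * k) : ℝ≥0) : ℝ) * ‖φ (x * y)‖ ^ 2)
          ≤ ‖h y‖ * ((((κ ^ (2 * k) : ℝ≥0) : ℝ) * (((borelHeight x)⁻¹ ^ (2 * k) : ℝ≥0) : ℝ)) * ‖φ (x * y)‖ ^ 2) :=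
            mul_le_mul_of_nonneg_left (mul_le_mul_of_nonneg_right (hw' y hy) (sq_nonneg _)) (norm_nonneg _)
        _ = _ := by ring
    · rw [hsupp y hy, norm_zero, zero_mul, zero_mul, mul_zero]
  -- (3) pointwise domination of the weighted integrand (off `Ω` both sides vanish)
  have hdom : ∀ y, (((borelHeight x)⁻¹ ^ (2 * k) : ℝ≥0) : ℝ) * (‖h y‖ * ‖φ (x * y)‖ ^ 2) ≤
      ((κ ^ (2 * k) : ℝ≥0) : ℝ) * (‖h y‖ * ((((borelHeight (x * y))⁻¹ ^ (2 * k) : ℝ≥0) : ℝ) * ‖φ (x * y)‖ ^ 2)) := by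
    intro y
    by_cases hy : y ∈ Ω
    · calc _ ≤ (((κ ^ (2 * k) : ℝ≥0) : ℝ) * (((borelHeight (x * y))⁻¹ ^ (2 * k) : ℝ≥0) : ℝ)) * (‖h y‖ * ‖φ (x * y)‖ ^ 2) :=
            mul_le_mul_of_nonneg_right (hw y hy) (mul_nonneg (norm_nonneg (h y)) (sq_nonneg ‖φ (x * y)‖))
        _ = _ := by ring
    · rw [hsupp y hy, norm_zero, zero_mul, zero_mul, mul_zero, mul_zero]
  calc (((borelHeight x)⁻¹ ^ (2 * k) : ℝ≥0) : ℝ) * ‖∫ y, h y * φ (x * y) ∂νG‖ ^ 2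
      ≤ (((borelHeight x)⁻¹ ^ (2 * k) : ℝ≥0) : ℝ) * ((∫ y, ‖h y‖ ∂νG) * ∫ y, ‖h y‖ * ‖φ (x * y)‖ ^ 2 ∂νG) :=
        mul_le_mul_of_nonneg_left (norm_sq_integral_mul_le νG hh hφm hφ2) (NNReal.coe_nonneg _)
    _ = (∫ y, ‖h y‖ ∂νG) * ∫ y, (((borelHeight x)⁻¹ ^ (2 * k) : ℝ≥0) : ℝ) * (‖h y‖ * ‖φ (x * y)‖ ^ 2) ∂νG := by
        rw [integral_const_mul]; ring
    _ ≤ (∫ y, ‖h y‖ ∂νG) * ∫ y, ((κ ^ (2 * k) : ℝ≥0) : ℝ) * (‖h y‖ * ((((borelHeight (x * y))⁻¹ ^ (2 * k) : ℝ≥0) : ℝ) * ‖φ (x * y)‖ ^ 2)) ∂νG :=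
        mul_le_mul_of_nonneg_left (integral_mono (hφ2.const_mul _) (hint2.const_mul _) hdom) (integral_nonneg fun y => norm_nonneg _)
    _ = ((κ ^ (2 * k) : ℝ≥0) : ℝ) * (∫ y, ‖h y‖ ∂νG) * ∫ y, ‖h y‖ * ((((borelHeight (x * y))⁻¹ ^ (2 * k) : ℝ≥0) : ℝ) * ‖φ (x * y)‖ ^ 2) ∂νG := by
        rw [integral_const_mul]; ring

end RightConv

end Summit.HodgeConjecture.HodgeConjecture.Cruxes.H413.K2E1BLHeckeOperatorWeightedU2

end
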